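import Summits.ABC.IUTFork.Repair.RHHeightScaling
import Summits.ABC.IUTFork.Repair.RHReqsideWeightLawsLabelOneCredit
import HarnessLib

/-!
# R-H ROUND 4, row R4OBJ-FACES — KERNEL FACES for the R4-6 class (iv) «HEIGHT-DEPENDENT ARCHIMEDEAN / INDETERMINACY SHARPENING c(h)»
# (census O-09) and its inflation member (O-09b): the SHARPENING sub-class is a BARRIER member (exponent −1, `NegExponent`, `¬ DoorAt`,
# never closed from an explicit height); the Ind2 LINEAR-INFLATION member is a `DoorAt` that does NOT close below the licence threshold and
# closes at it (PROOF-ONLY, 0 definitions)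

abc-iut cell, rung LADDER-ABC:A2.RESCUE.H, ROUND 4 (HUMAN D-0133 · D-0134 · D-0135; KEY `wake/KEY-abc-iut-rh2-w-2-R4OBJ-FACES.md`, abc-iut-rh-lead g5
2026-08-27T13:46:57Z; referee rh-ref-2). Seat abc-iut-rh2-w-2. INPUT OF RECORD: abc-iut-rh2-w-1's R4OBJ-ARCH file `plan/rescue/R-H/ROUND4/R4-6-ARCH-rh2-w-1.md`
7e7e90cddaf2fad9 (§2 definition, §3 derivation (D1)–(D5), §4 bed table 0aa25cfdebf27af1, §5 residual R-09 (a)/(b) «for rh2-w-2»). VOCABULARY BY NAME: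
abc-iut-rh2-T-1 `RH.HeightScaling` (p532994: `ExponentAtMost`, `NegExponent`, `DoorAt`, `PriceBounded`, `exponentAtMost_neg_one_of_le_const`,
`negExponent_of_priceBounded`, `not_doorAt_of_negExponent`, `doorAt_of_const_le`), this seat's BARRIER (p531802 `PowerBoundFrom`, `ClosedBy`,
`NeverClosedFrom`, `requirement`, `suppliedMass`, imported through p534825), abc-iut-rh2-w-1's p534825 `RH.ReqsideWeightLaws.LabelOneCredit`
(`not_closedBy_of_affine_bound`, `not_powerBoundFrom_linear_of_lt_one`).

THE CLASS LAW (rh2-w-1 §2/§3, cell currency, along the R78 ray `m_q ↦ s·m_q`, places / `l` / `e_w` / `D_w` / `R_in` / `R_out` fixed): under multipliers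
`c_D(s)` on Ind1 (different) and `c(s)` on Ind2 (log-shell radii) the PRICE of a cell is AFFINE in the multipliers and the DEMAND is free of them, so the
datum's kept mass obeys `kept(s) ≤ c_D(s)·A_δ + c(s)·A_G + B` with HEIGHT-FREE `A_δ, A_G ≥ 0`, `B` (the «∀-CERT» cap of (D2), an instance of p533167
`keptSlack_le_budget` at the scaled place); for the inflation member `c(s) = κ·s` (D4): `kept(s)/s → μ_∞(κ)·M₁` with `μ_∞(κ) ∈ (0, 1]`, `= 1` iff
`κ ≥ κ_lic`. The typed class (`ObjectClass` instance / profile family) is abc-iut-rh2-T-1's `RHHeightScalingR4Classes` (R4OBJ-TYPE, not landed at filing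
time); the faces below take the class law as an explicit HYPOTHESIS SHAPE on an abstract kept-mass profile `kept : ℝ → ℝ`, so the typed instance is a
one-line application once the definition lands (nothing re-typed, no modelling choice hidden: the hypotheses ARE (D2)/(D4) verbatim).

WHAT IS PROVED (namespace `Summit.ABC.IUTFork.Repair.RH.HeightScalingR4.ArchFace`, [folklore] real analysis):
* §1 SHARPENING SUB-CLASS (`0 ≤ c_D, c ≤ 1`: constant, decaying or vanishing — all eight bounded settings of the bed table): `kept_le_cap_of_boundedMultipliers`
  (`kept ≤ A_δ + A_G + B` height-free), **`archSharpening_exponentAtMost`** (`ExponentAtMost (kept/(s·M₁)) (−1) ((A_δ+A_G+B)/M₁)` = R-09 (a)),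
  `archSharpening_priceBounded`, **`archSharpening_negExponent`**, **`archSharpening_not_doorAt`**, **`archSharpening_not_closedBy`** (no closing at any `s ≥ 1`
  with `s > (A_δ+A_G+B+tol)/M₁`), `archSharpening_neverClosedFrom` ⇒ census word KILLED-BY-CONSISTENCY for the sharpening class (kernel face).
* §2 INFLATION MEMBER `c(s) = κ·s` (O-09b): **`archInflation_doorAt`** (`kept ≥ μ·M₁·s`, `μ > 0` ⇒ `DoorAt (kept/(s·M₁))`: exponent 0 — R-09 (b) first half),
  `powerBoundFrom_mono_of_le` + **`archInflation_not_powerBoundFrom`** (such a member has NO mass law with exponent `a < 1`: it sits OUTSIDE the Barrier's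
  antecedent — R-09 (b) second half, via p534825), **`archInflation_not_closedBy_below_licence`** (`kept ≤ μ_∞·M₁·s + E` with `μ_∞ < 1` ⇒ no closing at any
  `s ≥ s₁` with `s > (E+tol)/((1−μ_∞)·M₁)`: «DoorAt, NON-CLOSING» = KILLED-BY-DATA as a closer wherever `κ < κ_lic`, via p534825 `not_closedBy_of_affine_bound`),
  `archInflation_neverClosedFrom_below_licence`, **`archInflation_closedBy_at_licence`** (`kept ≥ M₁·s` from `s₁` on ⇒ closes at every `s ≥ s₁`, any `tol ≥ 0`:
  the `κ ≥ κ_lic` case — a LIVE door shape, untested as an OBJECT: nothing in print makes an indeterminacy radius grow with the height, rh2-w-1 §1 [L1]–[L5]).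
DELIBERATELY NOT HERE: the typed class definition (rh2-T-1), the bed numbers (rh2-w-1 / rh2-q3-num), the integer-side caps at the scaled place (rh2-w-1's
announced `RHReqsideArchSharpeningHeightScaling.lean`), any R4-1 door.
HONEST FRAMING: real analysis about OUR typed cell currency with the class law as hypothesis; every multiplier law other than print's `(1,1)` is a HYPOTHETICAL
parameter setting (claim-tagged in the class seat's file), never a Literature fact; KILLED-BY-CONSISTENCY / DoorAt are words about OUR profiles, not about
[IUTchIV] Thm. 1.10 in print; nothing here asserts that abc is proved or refuted, or takes a side on [IUTchIII] Cor. 3.12 / [IUTchIV] or on any author;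
typed ≠ proved; computed ≠ proved; a LIVE door is an untested opening, not a result.
-/

noncomputable section

open Finset

namespace Summit.ABC.IUTFork.Repair.RH.HeightScalingR4.ArchFace

open Summit.ABC.IUTFork.Repair.RH.HeightScaling Summit.ABC.IUTFork.Repair.RH.HeightScalingBarrier
  Summit.ABC.IUTFork.Repair.RH.ReqsideWeightLaws.LabelOneCredit

/-! ## §1. The SHARPENING sub-class: bounded multipliers keep the kept mass under a height-free cap ⇒ barrier member -/

/-- **Bounded multipliers ⇒ height-free cap**: if `kept(s) ≤ c_D(s)·A_δ + c(s)·A_G + B` for `s ≥ 1` with `0 ≤ c_D(s), c(s) ≤ 1` and `A_δ, A_G ≥ 0`, then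
`kept(s) ≤ A_δ + A_G + B` for every `s ≥ 1` (rh2-w-1 (D2): «every SHARPENING keeps e = −1 and lowers the constant»). [folklore] -/
theorem kept_le_cap_of_boundedMultipliers {kept cD c : ℝ → ℝ} {Aδ AG B : ℝ} (hAδ : 0 ≤ Aδ) (hAG : 0 ≤ AG)
    (hcD : ∀ s : ℝ, 1 ≤ s → 0 ≤ cD s ∧ cD s ≤ 1) (hc : ∀ s : ℝ, 1 ≤ s → 0 ≤ c s ∧ c s ≤ 1)
    (hlaw : ∀ s : ℝ, 1 ≤ s → kept s ≤ cD s * Aδ + c s * AG + B) :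
    ∀ s : ℝ, 1 ≤ s → kept s ≤ Aδ + AG + B := by
  intro s hs
  have h1 := (hcD s hs).2
  have h2 := (hc s hs).2
  have := hlaw s hs
  nlinarith

/-- **The sharpening profile is `PriceBounded M₁`** (abc-iut-rh2-T-1's class word): certificate `kept`, height-free bound `A_δ + A_G + B`. [folklore] -/
theorem archSharpening_priceBounded {kept cD c : ℝ → ℝ} {Aδ AG B : ℝ} (M₁ : ℝ) (hAδ : 0 ≤ Aδ) (hAG : 0 ≤ AG)
    (hcD : ∀ s : ℝ, 1 ≤ s → 0 ≤ cD s ∧ cD s ≤ 1) (hc : ∀ s : ℝ, 1 ≤ s → 0 ≤ c s ∧ c s ≤ 1)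
    (hlaw : ∀ s : ℝ, 1 ≤ s → kept s ≤ cD s * Aδ + c s * AG + B) :
    PriceBounded M₁ (fun s => kept s / (s * M₁)) :=
  ⟨kept, Aδ + AG + B, kept_le_cap_of_boundedMultipliers hAδ hAG hcD hc hlaw, fun _ _ => rfl⟩

/-- **R-09 (a): exponent −1 with the print cap** — `ExponentAtMost (kept/(s·M₁)) (−1) ((A_δ + A_G + B)/M₁)` for every bounded multiplier law
(abc-iut-rh2-T-1 `exponentAtMost_neg_one_of_le_const`). [folklore] -/
theorem archSharpening_exponentAtMost {kept cD c : ℝ → ℝ} {Aδ AG B M₁ : ℝ} (hM : 0 < M₁) (hAδ : 0 ≤ Aδ) (hAG : 0 ≤ AG)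
    (hcD : ∀ s : ℝ, 1 ≤ s → 0 ≤ cD s ∧ cD s ≤ 1) (hc : ∀ s : ℝ, 1 ≤ s → 0 ≤ c s ∧ c s ≤ 1)
    (hlaw : ∀ s : ℝ, 1 ≤ s → kept s ≤ cD s * Aδ + c s * AG + B) :
    ExponentAtMost (fun s => kept s / (s * M₁)) (-1) ((Aδ + AG + B) / M₁) :=
  exponentAtMost_neg_one_of_le_const hM (kept_le_cap_of_boundedMultipliers hAδ hAG hcD hc hlaw)

/-- **The sharpening sub-class has a NEGATIVE exponent** (`NegExponent`, abc-iut-rh2-T-1 `negExponent_of_priceBounded`). [folklore] -/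
theorem archSharpening_negExponent {kept cD c : ℝ → ℝ} {Aδ AG B M₁ : ℝ} (hM : 0 < M₁) (hAδ : 0 ≤ Aδ) (hAG : 0 ≤ AG)
    (hcD : ∀ s : ℝ, 1 ≤ s → 0 ≤ cD s ∧ cD s ≤ 1) (hc : ∀ s : ℝ, 1 ≤ s → 0 ≤ c s ∧ c s ≤ 1)
    (hlaw : ∀ s : ℝ, 1 ≤ s → kept s ≤ cD s * Aδ + c s * AG + B) :
    NegExponent (fun s => kept s / (s * M₁)) :=
  negExponent_of_priceBounded hM (archSharpening_priceBounded M₁ hAδ hAG hcD hc hlaw)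

/-- **… hence is NEVER a door** (`¬ DoorAt`; KILLED-BY-CONSISTENCY face for census O-09, sharpening sub-class). [folklore] -/
theorem archSharpening_not_doorAt {kept cD c : ℝ → ℝ} {Aδ AG B M₁ : ℝ} (hM : 0 < M₁) (hAδ : 0 ≤ Aδ) (hAG : 0 ≤ AG)
    (hcD : ∀ s : ℝ, 1 ≤ s → 0 ≤ cD s ∧ cD s ≤ 1) (hc : ∀ s : ℝ, 1 ≤ s → 0 ≤ c s ∧ c s ≤ 1)
    (hlaw : ∀ s : ℝ, 1 ≤ s → kept s ≤ cD s * Aδ + c s * AG + B) :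
    ¬ DoorAt (fun s => kept s / (s * M₁)) :=
  not_doorAt_of_negExponent (archSharpening_negExponent hM hAδ hAG hcD hc hlaw)

/-- **Mass face: the sharpening sub-class never closes the requirement beyond `(A_δ + A_G + B + tol)/M₁`** (the BARRIER's sharp conductor-type form,
p531802 `not_closedBy_of_heightFree`, one object). [folklore] -/
theorem archSharpening_not_closedBy {kept cD c : ℝ → ℝ} {Aδ AG B M₁ tol s : ℝ} (hM : 0 < M₁) (hAδ : 0 ≤ Aδ) (hAG : 0 ≤ AG)
    (hcD : ∀ s : ℝ, 1 ≤ s → 0 ≤ cD s ∧ cD s ≤ 1) (hc : ∀ s : ℝ, 1 ≤ s → 0 ≤ c s ∧ c s ≤ 1)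
    (hlaw : ∀ s : ℝ, 1 ≤ s → kept s ≤ cD s * Aδ + c s * AG + B) (h1 : 1 ≤ s) (hs : (Aδ + AG + B + tol) / M₁ < s) :
    ¬ ClosedBy (fun _ : Fin 1 => kept) M₁ tol s := by
  refine not_closedBy_of_heightFree (C := fun _ : Fin 1 => Aδ + AG + B) (s₁ := 1) hM
    (fun _ s' hs' => kept_le_cap_of_boundedMultipliers hAδ hAG hcD hc hlaw s' hs') h1 ?_
  simpa using hs

/-- **`NeverClosedFrom` for the sharpening sub-class**, explicit onset `max 1 ((A_δ + A_G + B + tol)/M₁ + 1)`. [folklore] -/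
theorem archSharpening_neverClosedFrom {kept cD c : ℝ → ℝ} {Aδ AG B M₁ tol : ℝ} (hM : 0 < M₁) (hAδ : 0 ≤ Aδ) (hAG : 0 ≤ AG)
    (hcD : ∀ s : ℝ, 1 ≤ s → 0 ≤ cD s ∧ cD s ≤ 1) (hc : ∀ s : ℝ, 1 ≤ s → 0 ≤ c s ∧ c s ≤ 1)
    (hlaw : ∀ s : ℝ, 1 ≤ s → kept s ≤ cD s * Aδ + c s * AG + B) :
    NeverClosedFrom (fun _ : Fin 1 => kept) M₁ tol (max 1 ((Aδ + AG + B + tol) / M₁ + 1)) := fun s hs =>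
  archSharpening_not_closedBy hM hAδ hAG hcD hc hlaw (le_trans (le_max_left _ _) hs)
    (by linarith [le_trans (le_max_right _ _) hs])

/-! ## §2. The Ind2 LINEAR-INFLATION member `c(s) = κ·s` (O-09b): a `DoorAt`, outside the Barrier, non-closing below the licence threshold -/

/-- **R-09 (b), first half: a linear lower bound is a door.** If `kept(s) ≥ μ·(M₁·s)` for `s ≥ 1` with `μ > 0` (rh2-w-1 (D4): `kept_j/s → min((j²−1)m, (j+1)κG)`,
`μ = μ_∞(κ) > 0`), then `DoorAt (kept/(s·M₁))` with constant `μ` (abc-iut-rh2-T-1 `doorAt_of_const_le`). [folklore] -/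
theorem archInflation_doorAt {kept : ℝ → ℝ} {μ M₁ : ℝ} (hM : 0 < M₁) (hμ : 0 < μ)
    (hlow : ∀ s : ℝ, 1 ≤ s → μ * (M₁ * s) ≤ kept s) :
    DoorAt (fun s => kept s / (s * M₁)) := by
  refine doorAt_of_const_le hμ fun s hs => ?_
  have hsM : 0 < s * M₁ := mul_pos (lt_of_lt_of_le zero_lt_one hs) hM
  rw [le_div_iff₀ hsM]
  calc μ * (s * M₁) = μ * (M₁ * s) := by ring
    _ ≤ kept s := hlow s hs

/-- A mass law transfers DOWN along a pointwise inequality: if `g ≤ f` on `s ≥ s₁` and `f` has `PowerBoundFrom f a C s₁`, so has `g`. [folklore] -/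
theorem powerBoundFrom_mono_of_le {f g : ℝ → ℝ} {a C s₁ : ℝ} (hfg : ∀ s : ℝ, s₁ ≤ s → g s ≤ f s)
    (hf : PowerBoundFrom f a C s₁) : PowerBoundFrom g a C s₁ :=
  fun s hs => (hfg s hs).trans (hf s hs)

/-- **R-09 (b), second half: the inflation member sits OUTSIDE the Barrier's antecedent** — a profile with `kept(s) ≥ μ·M₁·s` (`μ·M₁ > 0`) on `s ≥ 1`
admits NO mass law `PowerBoundFrom kept a C 1` with `a < 1` (abc-iut-rh2-w-1 p534825 `not_powerBoundFrom_linear_of_lt_one`, transferred up). [folklore] -/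
theorem archInflation_not_powerBoundFrom {kept : ℝ → ℝ} {μ M₁ a C : ℝ} (hM : 0 < M₁) (hμ : 0 < μ) (ha : a < 1)
    (hlow : ∀ s : ℝ, 1 ≤ s → μ * (M₁ * s) ≤ kept s) :
    ¬ PowerBoundFrom kept a C 1 := by
  intro h
  have hlin : PowerBoundFrom (fun s => (μ * M₁) * s) a C 1 :=
    powerBoundFrom_mono_of_le (fun s hs => by have := hlow s hs; nlinarith) h
  exact not_powerBoundFrom_linear_of_lt_one (mul_pos hμ hM) ha hlin

/-- **«DoorAt, NON-CLOSING» below the licence threshold**: if `kept(s) ≤ μ_∞·(M₁·s) + E` for `s ≥ s₁` with `μ_∞ < 1` (rh2-w-1 (D4): `κ < κ_lic`, `E` the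
height-free residue/price excess), then the member does not close `M₁·s − tol` at any `s ≥ s₁` with `s > (E + tol)/((1 − μ_∞)·M₁)` — KILLED-BY-DATA as a
closer on every datum with `κ < κ_lic` (abc-iut-rh2-w-1 p534825 `not_closedBy_of_affine_bound`). [folklore] -/
theorem archInflation_not_closedBy_below_licence {kept : ℝ → ℝ} {μinf E M₁ tol s₁ s : ℝ} (hM : 0 < M₁) (hμ : μinf < 1)
    (hup : ∀ s' : ℝ, s₁ ≤ s' → kept s' ≤ μinf * (M₁ * s') + E) (hs₁ : s₁ ≤ s)
    (hs : (E + tol) / ((1 - μinf) * M₁) < s) :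
    ¬ ClosedBy (fun _ : Fin 1 => kept) M₁ tol s := by
  have hcM : μinf * M₁ < M₁ := by nlinarith
  refine not_closedBy_of_affine_bound (A := E) (c := μinf * M₁) (s₁ := s₁) hcM (fun s' hs' => ?_) hs₁ ?_
  · unfold suppliedMass
    simp only [Finset.univ_unique, Fin.default_eq_zero, Finset.sum_singleton]
    have := hup s' hs'
    linarith
  · have h' : M₁ - μinf * M₁ = (1 - μinf) * M₁ := by ring
    rwa [h']

/-- `NeverClosedFrom` for the inflation member below the licence threshold, explicit onset. [folklore] -/
theorem archInflation_neverClosedFrom_below_licence {kept : ℝ → ℝ} {μinf E M₁ tol s₁ : ℝ} (hM : 0 < M₁) (hμ : μinf < 1)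
    (hup : ∀ s' : ℝ, s₁ ≤ s' → kept s' ≤ μinf * (M₁ * s') + E) :
    NeverClosedFrom (fun _ : Fin 1 => kept) M₁ tol (max s₁ ((E + tol) / ((1 - μinf) * M₁) + 1)) := fun s hs =>
  archInflation_not_closedBy_below_licence hM hμ hup (le_trans (le_max_left _ _) hs)
    (by linarith [le_trans (le_max_right _ _) hs])

/-- **AT the licence threshold (`κ ≥ κ_lic`): every cell licensed asymptotically, `kept(s) ≥ M₁·s` from `s₁` on ⇒ the member CLOSES the requirement at every
`s ≥ s₁`, any `tol ≥ 0`** — the LIVE door SHAPE of O-09b (rh2-w-1 bed: 0·0·6/133, 5·15·15/79, 0·12·132/482 data at κ = ½·1·2; κ_lic finite on a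
minority of data only; no such OBJECT located in print). [folklore] -/
theorem archInflation_closedBy_at_licence {kept : ℝ → ℝ} {M₁ tol s₁ s : ℝ} (htol : 0 ≤ tol)
    (hfull : ∀ s' : ℝ, s₁ ≤ s' → M₁ * s' ≤ kept s') (hs : s₁ ≤ s) :
    ClosedBy (fun _ : Fin 1 => kept) M₁ tol s := by
  have h := hfull s hs
  unfold ClosedBy suppliedMass requirement
  simp only [Finset.univ_unique, Fin.default_eq_zero, Finset.sum_singleton]
  linarith

/-- **The dichotomy of the inflation member in one statement**: DoorAt always (`μ > 0`); never closed from an explicit height if `μ_∞ < 1`; closed at every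
height past `s₁` if the full mass is reached. [folklore] -/
theorem archInflation_dichotomy {kept : ℝ → ℝ} {μ μinf E M₁ tol s₁ : ℝ} (hM : 0 < M₁) (hμ : 0 < μ) (htol : 0 ≤ tol)
    (hlow : ∀ s : ℝ, 1 ≤ s → μ * (M₁ * s) ≤ kept s) :
    DoorAt (fun s => kept s / (s * M₁)) ∧
      ((μinf < 1 ∧ ∀ s' : ℝ, s₁ ≤ s' → kept s' ≤ μinf * (M₁ * s') + E) →
        NeverClosedFrom (fun _ : Fin 1 => kept) M₁ tol (max s₁ ((E + tol) / ((1 - μinf) * M₁) + 1))) ∧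
      ((∀ s' : ℝ, s₁ ≤ s' → M₁ * s' ≤ kept s') → ∀ s : ℝ, s₁ ≤ s → ClosedBy (fun _ : Fin 1 => kept) M₁ tol s) :=
  ⟨archInflation_doorAt hM hμ hlow, fun h => archInflation_neverClosedFrom_below_licence hM h.1 h.2,
    fun hfull _ hs => archInflation_closedBy_at_licence htol hfull hs⟩

end Summit.ABC.IUTFork.Repair.RH.HeightScalingR4.ArchFace

end
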